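import Summits.AtomisticToContinuum.HydrodynamicLimit.Theses.AdiabaticParcels

/-!
# Birth skeleton of the crux `AdiabaticClosure` (stmt-AtomisticToContinuum-17362)

Route `route-AtomisticToContinuum-AdiabaticParcels`, crux decl
`Summit.AtomisticToContinuum.HydrodynamicLimit.Theses.AdiabaticParcels.AdiabaticClosure`
(packing-guarded, rev 15: given the kinematic limits — density and momentum fields at every
`s ∈ [0,T)` — the empirical ENERGY field converges at every `t ∈ [0,T)` to `∫ χ E_t`,
`E = ρ(|u|²/2 + 3θ/2)`).
Skeleton registrar `planner-skel-stmt-AtomisticToContinuum-17362-0`, 2026-08-17 (BC3 birth certificate of the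
crux; re-audit bin REPAIRABLE). Nothing here restates the crux or the Statement. The line is the route's own
foreseen layer-2 cut "LocalIsotropy → ContactPressure → AdiabaticClosure" (route header, TWO-LAYER PLAN), typed
WALL-FREE and FLUX-LEVEL around one observation special to hard spheres:

* ATHERMAL LINEARITY. Hard spheres have no energy scale: all internal energy is kinetic,
  `ε_int = E − ρ|u|²/2 = (3/2)ρθ`, and the pressure `p = ρθ Z(ρσ³) = (2/3) Z(ρσ³) ε_int` is LINEAR in the
  energy density at given density. Hence, GIVEN the kinematic fields `(ρ, u)` (the crux's hypothesis), the
  Euler energy equation `∂ₜE + div((E + p)u) = 0` is a LINEAR scalar transport equation for `E`,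
  `∂ₜE + div(a E u) = div(b u)`, `a = 1 + (2/3)Z(ρσ³)`, `b = (1/3)Z(ρσ³)ρ|u|²`, with smooth coefficients in the
  dilute band (virial analyticity, in tree: `Theorems.hsEosLowDensity_proof`). A linear transport equation with
  smooth coefficients on `𝕋³` has ONE distributional solution per initial datum (duality / characteristics), and
  that is exactly the amount of uniqueness a limit-in-probability of tested random fields can use. So the crux
  splits into: the microscopic energy balance CLOSES in the athermal form (two stubs, the kinetic and the
  collisional half of the energy current), and closure FORCES convergence (one stub, pure analysis).
* THE OBJECTS (§0). For a flow `Φ`, a space–time test function `φ` (smooth on `[0,T) × 𝕋³`, one-sided at `0`,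
  `Torus.IsSmoothSpaceTimeOn (Ico 0 T)` exactly as the solution class) and a configuration `z`:
  the tested empirical KINETIC ENERGY CURRENT `⟨j_N, F⟩ = N⁻¹ ∑ᵢ (|vᵢ|²/2) ⟪vᵢ, F(qᵢ)⟫` (`kineticEnergyCurrent`);
  the STREAMING DEFECT `X_N(t, φ) = ∫₀ᵗ [⟨j_N(s), ∇φ_s⟩ − (5/3)⟨e_N(s), u_s·∇φ_s⟩ + (1/3)∫ρ_s|u_s|² u_s·∇φ_s] ds`
  (`streamingDefect`; `(5/3)E − (1/3)ρ|u|² = E + (2/3)ε_int` is the ideal-gas part of the energy flux);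
  the COLLISIONAL TRANSFER functional `C_N(t, φ) = ⟨e_N(t), φ_t⟩ − ⟨e_N(0), φ_0⟩ − ∫₀ᵗ [⟨e_N(s), ∂ₛφ_s⟩ +
  ⟨j_N(s), ∇φ_s⟩] ds` (`collisionalTransfer`: along a hard-sphere trajectory this remainder is EXACTLY the sum
  over collisions in `[0,t]` of `N⁻¹(φ(qᵢ) − φ(qⱼ)) Δ(|vᵢ|²/2)`, the tested collisional energy current — defined
  as the remainder so that no collision bookkeeping enters the signatures); and the TRANSFER DEFECT
  `Y_N(t, φ) = C_N(t, φ) − (2/3)∫₀ᵗ [⟨e_N(s), (Z(ρ_sσ³) − 1) u_s·∇φ_s⟩ − ∫(Z(ρ_sσ³) − 1) ρ_s|u_s|²/2 u_s·∇φ_s] ds`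
  (`transferDefect`; `(2/3)(Z − 1)ε_int = ρθ(Z − 1) = p_exc` is the excess, collisional-transfer pressure).
  Check: the two closures add up to the flux `E u + (2/3)Z ε_int u = (E + p)u` of the Euler energy equation.
* `stub_kineticIsotropy` (K = the route's LocalIsotropy; size XL, THE HEART together with C): in the crux's
  frame (guarded classical solution, probability local Gibbs laws, fields converging at `t = 0`, kinematic
  limits at every `s < T`) the streaming defect vanishes in probability, `P_N(|X_N(t, φ)| > δ) → 0`, for every
  smooth `φ` and `t < T`. Content: window-averaged ODD third moments (kinetic heat flux) and the TRACELESS second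
  moments of the peculiar velocities `vᵢ − u(qᵢ)` vanish at Euler order along the non-equilibrium evolution —
  local velocity isotropy, a 1-body statement over kinetic times; the first-moment replacements are free given
  the kinematic limits. Why it might fail = the crux's why-line: an `O(1)` rest-frame heat flux (the free-gas
  witness `h_C` of `BoltzmannHypothesisBarrierNarrow`) — collisions at fixed `σ > 0` must kill it; nobody has
  proved they do.
* `stub_contactTransfer` (C = the route's ContactPressure; size XL): in the same frame the transfer defect
  vanishes in probability, `P_N(|Y_N(t, φ)| > δ) → 0`: the collisional transfer of energy has its
  local-equilibrium CONTACT VALUE — pair correlation at contact `g(σ⁺)` with `(2π/3)ρσ³ g(σ⁺) = Z − 1` (contact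
  value theorem, ChapmanCowling1970 §16.4; in tree `HardSphereContactTheorem`), isotropic Maxwellian relative
  velocities at contact (no collisional heat flux, no deviatoric collisional stress at Euler order), and the
  exact pathwise identity "remainder = collision sum" (cf. the landed mass identity
  `IsHardSphereTrajectory.sub_eq_integral_add_collisionalTransfer`). Why it might fail: needs the two-point
  function AT CONTACT along a deterministic non-equilibrium evolution at fixed density — local equilibrium at
  the pair level, open (Spohn1991 I.3).
* `stub_athermalDuality` (D, the glue the route's two-step plan left implicit; size M–L, provable now in
  principle): in the guarded frame (NO kinematic limits needed), IF both defects vanish for every smooth `φ`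
  and every `t < T`, THEN the energy field converges at every `t < T` to `∫χE_t`. Proof plan: below the virial
  radius `a = 1 + (2/3)Z(ρσ³)` is smooth on `[0,T) × 𝕋³` (`ρ > 0`, guard, `hsEosLowDensity_proof`); for smooth
  `χ'` solve the adjoint transport `∂ₛφ + a u·∇φ = 0`, `φ(t) = χ'` on `[0,T)` (characteristics of the smooth
  field `a u` on the compact torus); pathwise on the good set (locally finite collisions, free flight,
  `N⁻¹∑` linear in the test function) `X_N + Y_N = ⟨e_N(t), χ'⟩ − ⟨e_N(0), φ_0⟩ − ∫₀ᵗ⟨e_N(s), ∂ₛφ + a u·∇φ⟩ +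
  (1/3)∫₀ᵗ∫ Zρ|u|² u·∇φ`, whose middle term is `⟨e_N(s), 0⟩ = 0`; the classical energy equation gives the same
  identity for `E` exactly (torus integration by parts, `hsPressure = (2/3)Z ε_int`); the time-`0` LLN moves
  `⟨e_N(0), φ_0⟩ → ∫φ_0E_0`; finally `|⟨e_N(t), χ − χ'⟩| ≤ ‖χ − χ'‖_∞ ⟨e_N(0), 1⟩` by pathwise energy
  conservation. Why it might fail: only through typing (junk `∫` off the good set is a null event; `T ≤ 0` is
  vacuous on both sides).
* Composition `AdiabaticClosure_of : K → C → D → AdiabaticClosure` (sorry-free): packing threshold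
  `min ηK (min ηC ηD)`, density threshold `min σK (min σC σD)`, the guard pushed to each threshold, the two
  closures fed to the duality at each `t`. `AdiabaticClosure_skeleton` = the crux modulo the three sorries.

Disproof used: none exists for this crux (`ledger crux ls stmt-AtomisticToContinuum-17362`: no workfiles at
registration). Negatives index (20 entries, 2026-08-17): none is an instance of K, C, D — all three carry the
crux's packing guard (`∃ η` outermost, `ρσ³ < η`: the EOS junk branch at packing `≥ 512` that killed
`AdjointEnskogTestFamily` stmt-9168 is out of range), the tie to the local Gibbs data at `t = 0`, and `N → ∞`
conclusions in probability (no finite-`N`/degenerate-cell instance as in 9236/9238/6610/6612); for `T ≤ 0` every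
stub is vacuous exactly like the crux.
-/

noncomputable section

open MeasureTheory Filter Set
open scoped ENNReal Topology InnerProductSpace

namespace Summit.AtomisticToContinuum.HydrodynamicLimit.Cruxes.AdiabaticClosure.Birth

open Literature.MathematicalPhysics.KineticTheory
open Summit.AtomisticToContinuum.HydrodynamicLimit.Theses
open Summit.AtomisticToContinuum.HydrodynamicLimit.Theses.AdiabaticParcels

/-! ## §0 Objects of the line -/

/-- The empirical **kinetic energy current** of a configuration tested against a vector field `F`:
`⟨j_N, F⟩ = N⁻¹ ∑ᵢ (|vᵢ|²/2) ⟪vᵢ, F(qᵢ)⟫` (same normalisation as `empiricalEnergyField`). -/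
def kineticEnergyCurrent {n : ℕ} (z : Literature.Analysis.FluidPDE.Config n (Fin 3) T3) (F : T3 → V3) : ℝ :=
  ∫ y, ‖y.2‖ ^ 2 / 2 * ⟪y.2, F y.1⟫_ℝ ∂Literature.Analysis.FluidPDE.empiricalMeasure z

/-- The **streaming defect** `X_N(t, φ)(z)`: the time-integrated tested kinetic energy current minus its
athermal ideal-gas closure `(5/3)⟨e_N, u·∇φ⟩ − (1/3)∫ρ|u|² u·∇φ` (kinematic limit fields `ρ, u`). -/
def streamingDefect (σ : ℝ) (ρ : ℝ → T3 → ℝ) (u : ℝ → T3 → V3) {N : ℕ}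
    (Φ : Literature.Analysis.FluidPDE.HardSphereFlow (Literature.Analysis.FluidPDE.Torus.geometry (Fin 3))
      (hsDiameter σ N) (N + 1))
    (φ : ℝ → T3 → ℝ) (t : ℝ) (z : Literature.Analysis.FluidPDE.Config (N + 1) (Fin 3) T3) : ℝ :=
  ∫ s in (0 : ℝ)..t,
    (kineticEnergyCurrent (Φ.flow s z) (Literature.Analysis.FunctionSpaces.Torus.gradient (φ s))
      - 5 / 3 * empiricalEnergyField (Φ.flow s z)
          (fun x => ⟪u s x, Literature.Analysis.FunctionSpaces.Torus.gradient (φ s) x⟫_ℝ)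
      + 1 / 3 * ∫ x, ρ s x * ‖u s x‖ ^ 2 *
          ⟪u s x, Literature.Analysis.FunctionSpaces.Torus.gradient (φ s) x⟫_ℝ)

/-- The **collisional transfer functional** `C_N(t, φ)(z) = ⟨e_N(t), φ_t⟩ − ⟨e_N(0), φ_0⟩ −
∫₀ᵗ [⟨e_N(s), ∂ₛφ_s⟩ + ⟨j_N(s), ∇φ_s⟩] ds` (time derivative one-sided within `[0,T)`): along a hard-sphere
trajectory, exactly the collision sum `∑ N⁻¹(φ(qᵢ) − φ(qⱼ))Δ(|vᵢ|²/2)` over `[0,t]`. -/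
def collisionalTransfer (σ T : ℝ) {N : ℕ}
    (Φ : Literature.Analysis.FluidPDE.HardSphereFlow (Literature.Analysis.FluidPDE.Torus.geometry (Fin 3))
      (hsDiameter σ N) (N + 1))
    (φ : ℝ → T3 → ℝ) (t : ℝ) (z : Literature.Analysis.FluidPDE.Config (N + 1) (Fin 3) T3) : ℝ :=
  empiricalEnergyField (Φ.flow t z) (φ t) - empiricalEnergyField (Φ.flow 0 z) (φ 0)
    - ∫ s in (0 : ℝ)..t,
        (empiricalEnergyField (Φ.flow s z)
            (Literature.Analysis.FunctionSpaces.Torus.timeDerivWithin (Ico 0 T) φ s)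
          + kineticEnergyCurrent (Φ.flow s z) (Literature.Analysis.FunctionSpaces.Torus.gradient (φ s)))

/-- The **transfer defect** `Y_N(t, φ)(z)`: the collisional transfer functional minus its local-equilibrium
contact closure `(2/3)∫₀ᵗ [⟨e_N, (Z(ρσ³) − 1) u·∇φ⟩ − ∫(Z(ρσ³) − 1)ρ|u|²/2 u·∇φ] ds`
(`Z = hsCompressibility`, excess pressure `p_exc = (2/3)(Z − 1)ε_int`). -/
def transferDefect (σ T : ℝ) (ρ : ℝ → T3 → ℝ) (u : ℝ → T3 → V3) {N : ℕ}
    (Φ : Literature.Analysis.FluidPDE.HardSphereFlow (Literature.Analysis.FluidPDE.Torus.geometry (Fin 3))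
      (hsDiameter σ N) (N + 1))
    (φ : ℝ → T3 → ℝ) (t : ℝ) (z : Literature.Analysis.FluidPDE.Config (N + 1) (Fin 3) T3) : ℝ :=
  collisionalTransfer σ T Φ φ t z
    - 2 / 3 * ∫ s in (0 : ℝ)..t,
        (empiricalEnergyField (Φ.flow s z)
            (fun x => (hsCompressibility (ρ s x * σ ^ 3) - 1) *
              ⟪u s x, Literature.Analysis.FunctionSpaces.Torus.gradient (φ s) x⟫_ℝ)
          - ∫ x, (hsCompressibility (ρ s x * σ ^ 3) - 1) * (ρ s x * ‖u s x‖ ^ 2 / 2) *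
              ⟪u s x, Literature.Analysis.FunctionSpaces.Torus.gradient (φ s) x⟫_ℝ)

/-- **The kinematic limits** — verbatim the hypothesis of the crux: at every `s ∈ [0,T)` the empirical
density and momentum fields converge in probability to `∫χρ_s`, `∫χρ_s u_s`. -/
def KinematicLimits (σ : ℝ) (a₀ : T3 → ℝ) (u₀ : T3 → V3) (θ₀ : T3 → ℝ)
    (Φ : (N : ℕ) → Literature.Analysis.FluidPDE.HardSphereFlow
      (Literature.Analysis.FluidPDE.Torus.geometry (Fin 3)) (hsDiameter σ N) (N + 1))
    (ρ : ℝ → T3 → ℝ) (u : ℝ → T3 → V3) (T : ℝ) : Prop :=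
  ∀ s ∈ Set.Ico 0 T,
    (∀ χ : T3 → ℝ, Continuous χ → ∀ δ : ℝ, 0 < δ →
      Tendsto (fun N => localGibbsLaw σ a₀ u₀ θ₀ N (Φ N)
        {z | δ < |empiricalDensityField ((Φ N).flow s z) χ - ∫ x, χ x * ρ s x|}) atTop (𝓝 0)) ∧
    (∀ χ : T3 → ℝ, Continuous χ → ∀ δ : ℝ, 0 < δ →
      Tendsto (fun N => localGibbsLaw σ a₀ u₀ θ₀ N (Φ N)
        {z | δ < ‖empiricalMomentumField ((Φ N).flow s z) χ - ∫ x, (χ x * ρ s x) • u s x‖}) atTop (𝓝 0))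

/-- **The energy limits** — verbatim the conclusion of the crux: at every `t ∈ [0,T)` the empirical energy
field converges in probability to `∫χE_t`. -/
def EnergyLimits (σ : ℝ) (a₀ : T3 → ℝ) (u₀ : T3 → V3) (θ₀ : T3 → ℝ)
    (Φ : (N : ℕ) → Literature.Analysis.FluidPDE.HardSphereFlow
      (Literature.Analysis.FluidPDE.Torus.geometry (Fin 3)) (hsDiameter σ N) (N + 1))
    (ρ : ℝ → T3 → ℝ) (u : ℝ → T3 → V3) (θ : ℝ → T3 → ℝ) (T : ℝ) : Prop :=
  ∀ t ∈ Set.Ico 0 T, ∀ χ : T3 → ℝ, Continuous χ → ∀ δ : ℝ, 0 < δ →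
    Tendsto (fun N => localGibbsLaw σ a₀ u₀ θ₀ N (Φ N)
      {z | δ < |empiricalEnergyField ((Φ N).flow t z) χ -
        ∫ x, χ x * totalEnergyDensity (ρ t x) (u t x) (θ t x)|}) atTop (𝓝 0)

/-- **The kinetic half of the energy balance closes**: for every space–time test function smooth on
`[0,T) × 𝕋³` and every `t ∈ [0,T)`, the streaming defect vanishes in probability. -/
def StreamingCloses (σ : ℝ) (a₀ : T3 → ℝ) (u₀ : T3 → V3) (θ₀ : T3 → ℝ)
    (Φ : (N : ℕ) → Literature.Analysis.FluidPDE.HardSphereFlow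
      (Literature.Analysis.FluidPDE.Torus.geometry (Fin 3)) (hsDiameter σ N) (N + 1))
    (ρ : ℝ → T3 → ℝ) (u : ℝ → T3 → V3) (T : ℝ) : Prop :=
  ∀ φ : ℝ → T3 → ℝ, Literature.Analysis.FunctionSpaces.Torus.IsSmoothSpaceTimeOn (Ico 0 T) φ →
    ∀ t ∈ Set.Ico 0 T, ∀ δ : ℝ, 0 < δ →
      Tendsto (fun N => localGibbsLaw σ a₀ u₀ θ₀ N (Φ N)
        {z | δ < |streamingDefect σ ρ u (Φ N) φ t z|}) atTop (𝓝 0)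

/-- **The collisional half of the energy balance closes**: for every space–time test function smooth on
`[0,T) × 𝕋³` and every `t ∈ [0,T)`, the transfer defect vanishes in probability. -/
def TransferCloses (σ : ℝ) (a₀ : T3 → ℝ) (u₀ : T3 → V3) (θ₀ : T3 → ℝ)
    (Φ : (N : ℕ) → Literature.Analysis.FluidPDE.HardSphereFlow
      (Literature.Analysis.FluidPDE.Torus.geometry (Fin 3)) (hsDiameter σ N) (N + 1))
    (ρ : ℝ → T3 → ℝ) (u : ℝ → T3 → V3) (T : ℝ) : Prop :=
  ∀ φ : ℝ → T3 → ℝ, Literature.Analysis.FunctionSpaces.Torus.IsSmoothSpaceTimeOn (Ico 0 T) φ →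
    ∀ t ∈ Set.Ico 0 T, ∀ δ : ℝ, 0 < δ →
      Tendsto (fun N => localGibbsLaw σ a₀ u₀ θ₀ N (Φ N)
        {z | δ < |transferDefect σ T ρ u (Φ N) φ t z|}) atTop (𝓝 0)

/-! ## §1 Stub signatures

Each stub's statement is the `Prop` `Sig.stub_<name>`; the registered obligation is
`theorem stub_<name> : Sig.stub_<name> := by sorry` (§2); the composition `AdiabaticClosure_of` takes the
three signatures as hypotheses BY NAME. All three live in the crux's own frame: packing threshold outermost,
continuous positive profiles, `σ < σ₀(profiles)`, classical solution with the packing guard, flows, probability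
local Gibbs laws, fields converging at `t = 0`. -/

/-- **K — kinetic isotropy (the route's LocalIsotropy; XL).** In the crux's frame and given the kinematic
limits, the streaming defect vanishes in probability for every smooth space–time test function. -/
def Sig.stub_kineticIsotropy : Prop :=
  ∃ ηK : ℝ, 0 < ηK ∧
    ∀ (a₀ θ₀ : T3 → ℝ) (u₀ : T3 → V3), Continuous a₀ → Continuous θ₀ → Continuous u₀ →
      (∀ x, 0 < a₀ x) → (∀ x, 0 < θ₀ x) →
      ∃ σ₀ : ℝ, 0 < σ₀ ∧ ∀ σ : ℝ, 0 < σ → σ < σ₀ →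
        ∀ (T : ℝ) (ρ θ : ℝ → T3 → ℝ) (u : ℝ → T3 → V3), IsHardSphereEulerSolution σ T ρ u θ →
          (∀ t ∈ Set.Ico 0 T, ∀ x, ρ t x * σ ^ 3 < ηK) →
          ∀ Φ : (N : ℕ) → Literature.Analysis.FluidPDE.HardSphereFlow
              (Literature.Analysis.FluidPDE.Torus.geometry (Fin 3)) (hsDiameter σ N) (N + 1),
            (∀ N, IsProbabilityMeasure (localGibbsLaw σ a₀ u₀ θ₀ N (Φ N))) →
            TendstoHydroFieldsAt (fun N => localGibbsLaw σ a₀ u₀ θ₀ N (Φ N)) Φ ρ u θ 0 →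
            KinematicLimits σ a₀ u₀ θ₀ Φ ρ u T →
              StreamingCloses σ a₀ u₀ θ₀ Φ ρ u T

/-- **C — contact transfer (the route's ContactPressure; XL).** In the crux's frame and given the kinematic
limits, the transfer defect vanishes in probability for every smooth space–time test function. -/
def Sig.stub_contactTransfer : Prop :=
  ∃ ηC : ℝ, 0 < ηC ∧
    ∀ (a₀ θ₀ : T3 → ℝ) (u₀ : T3 → V3), Continuous a₀ → Continuous θ₀ → Continuous u₀ →
      (∀ x, 0 < a₀ x) → (∀ x, 0 < θ₀ x) →
      ∃ σ₀ : ℝ, 0 < σ₀ ∧ ∀ σ : ℝ, 0 < σ → σ < σ₀ →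
        ∀ (T : ℝ) (ρ θ : ℝ → T3 → ℝ) (u : ℝ → T3 → V3), IsHardSphereEulerSolution σ T ρ u θ →
          (∀ t ∈ Set.Ico 0 T, ∀ x, ρ t x * σ ^ 3 < ηC) →
          ∀ Φ : (N : ℕ) → Literature.Analysis.FluidPDE.HardSphereFlow
              (Literature.Analysis.FluidPDE.Torus.geometry (Fin 3)) (hsDiameter σ N) (N + 1),
            (∀ N, IsProbabilityMeasure (localGibbsLaw σ a₀ u₀ θ₀ N (Φ N))) →
            TendstoHydroFieldsAt (fun N => localGibbsLaw σ a₀ u₀ θ₀ N (Φ N)) Φ ρ u θ 0 →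
            KinematicLimits σ a₀ u₀ θ₀ Φ ρ u T →
              TransferCloses σ a₀ u₀ θ₀ Φ ρ u T

/-- **D — athermal duality (M–L; the glue lemma).** In the crux's frame (no kinematic limits needed): if both
halves of the energy balance close for every smooth space–time test function, the energy field converges at
every `t ∈ [0,T)` — linear transport with smooth coefficients below the virial radius has one solution. -/
def Sig.stub_athermalDuality : Prop :=
  ∃ ηD : ℝ, 0 < ηD ∧
    ∀ (a₀ θ₀ : T3 → ℝ) (u₀ : T3 → V3), Continuous a₀ → Continuous θ₀ → Continuous u₀ →
      (∀ x, 0 < a₀ x) → (∀ x, 0 < θ₀ x) →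
      ∃ σ₀ : ℝ, 0 < σ₀ ∧ ∀ σ : ℝ, 0 < σ → σ < σ₀ →
        ∀ (T : ℝ) (ρ θ : ℝ → T3 → ℝ) (u : ℝ → T3 → V3), IsHardSphereEulerSolution σ T ρ u θ →
          (∀ t ∈ Set.Ico 0 T, ∀ x, ρ t x * σ ^ 3 < ηD) →
          ∀ Φ : (N : ℕ) → Literature.Analysis.FluidPDE.HardSphereFlow
              (Literature.Analysis.FluidPDE.Torus.geometry (Fin 3)) (hsDiameter σ N) (N + 1),
            (∀ N, IsProbabilityMeasure (localGibbsLaw σ a₀ u₀ θ₀ N (Φ N))) →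
            TendstoHydroFieldsAt (fun N => localGibbsLaw σ a₀ u₀ θ₀ N (Φ N)) Φ ρ u θ 0 →
            StreamingCloses σ a₀ u₀ θ₀ Φ ρ u T → TransferCloses σ a₀ u₀ θ₀ Φ ρ u T →
              EnergyLimits σ a₀ u₀ θ₀ Φ ρ u θ T

/-! ## §2 Stubs (registered; `sorry` only inside them) — hardest: `stub_kineticIsotropy` /
`stub_contactTransfer` (the two halves of local equilibrium at flux level) -/

/-- **K (XL).** Local velocity isotropy at Euler order: the streaming defect vanishes in probability. -/
theorem stub_kineticIsotropy : Sig.stub_kineticIsotropy := by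
  sorry

/-- **C (XL).** Contact value of the collisional energy transfer: the transfer defect vanishes in probability. -/
theorem stub_contactTransfer : Sig.stub_contactTransfer := by
  sorry

/-- **D (M–L).** Athermal duality: closure of both halves of the energy balance forces the energy field. -/
theorem stub_athermalDuality : Sig.stub_athermalDuality := by
  sorry

/-! ## §3 Composition (sorry-free) -/

/-- **The line closes the crux modulo its stubs**: `AdiabaticClosure` BY NAME from K, C, D. Content: the common
packing threshold `min ηK (min ηC ηD)` and density threshold `min σK (min σC σD)`, the guard pushed to each,
the kinematic limits fed to K and C, and both closures fed to the duality D. -/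
theorem AdiabaticClosure_of (hK : Sig.stub_kineticIsotropy) (hC : Sig.stub_contactTransfer)
    (hD : Sig.stub_athermalDuality) : AdiabaticParcels.AdiabaticClosure := by
  obtain ⟨ηK, hηK, HK⟩ := hK
  obtain ⟨ηC, hηC, HC⟩ := hC
  obtain ⟨ηD, hηD, HD⟩ := hD
  refine ⟨min ηK (min ηC ηD), lt_min hηK (lt_min hηC hηD), ?_⟩
  intro a₀ θ₀ u₀ ha hθ hu ha0 hθ0
  obtain ⟨σK, hσK, GK⟩ := HK a₀ θ₀ u₀ ha hθ hu ha0 hθ0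
  obtain ⟨σC, hσC, GC⟩ := HC a₀ θ₀ u₀ ha hθ hu ha0 hθ0
  obtain ⟨σD, hσD, GD⟩ := HD a₀ θ₀ u₀ ha hθ hu ha0 hθ0
  refine ⟨min σK (min σC σD), lt_min hσK (lt_min hσC hσD), ?_⟩
  intro σ hσ hσlt T ρ θ u hsol hG Φ hP h0 hkin
  have hσK' : σ < σK := lt_of_lt_of_le hσlt (min_le_left _ _)
  have hσC' : σ < σC := lt_of_lt_of_le hσlt ((min_le_right _ _).trans (min_le_left _ _))
  have hσD' : σ < σD := lt_of_lt_of_le hσlt ((min_le_right _ _).trans (min_le_right _ _))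
  have hGK : ∀ s ∈ Set.Ico 0 T, ∀ x, ρ s x * σ ^ 3 < ηK :=
    fun s hs x => lt_of_lt_of_le (hG s hs x) (min_le_left _ _)
  have hGC : ∀ s ∈ Set.Ico 0 T, ∀ x, ρ s x * σ ^ 3 < ηC :=
    fun s hs x => lt_of_lt_of_le (hG s hs x) ((min_le_right _ _).trans (min_le_left _ _))
  have hGD : ∀ s ∈ Set.Ico 0 T, ∀ x, ρ s x * σ ^ 3 < ηD :=
    fun s hs x => lt_of_lt_of_le (hG s hs x) ((min_le_right _ _).trans (min_le_right _ _))
  -- K: the kinetic half of the energy balance closes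
  have hX : StreamingCloses σ a₀ u₀ θ₀ Φ ρ u T := GK σ hσ hσK' T ρ θ u hsol hGK Φ hP h0 hkin
  -- C: the collisional half closes
  have hY : TransferCloses σ a₀ u₀ θ₀ Φ ρ u T := GC σ hσ hσC' T ρ θ u hsol hGC Φ hP h0 hkin
  -- D: athermal duality forces the energy field
  exact GD σ hσ hσD' T ρ θ u hsol hGD Φ hP h0 hX hY

/-- The skeleton instantiated: the crux modulo the three registered stubs. -/
theorem AdiabaticClosure_skeleton : AdiabaticParcels.AdiabaticClosure :=
  AdiabaticClosure_of stub_kineticIsotropy stub_contactTransfer stub_athermalDuality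

end Summit.AtomisticToContinuum.HydrodynamicLimit.Cruxes.AdiabaticClosure.Birth

end
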